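import Literature.NumberTheory.Automorphic.GaloisActionPlaces
import Mathlib.NumberTheory.NumberField.AdeleRing
import Mathlib.NumberTheory.NumberField.InfinitePlace.Ramification
import HarnessLib

/-!
# Galois action on the adele ring

Topic `NumberTheory/Automorphic` (infrastructure for base change, Arthur–Clozel Ch. 3: the
automorphism `σ` of `GL_n(𝔸_E)` and the conjugate `Π^σ` of an automorphic representation);
namespace `Literature.Automorphic`. Continues `GaloisActionPlaces` (action on finite places,
transport of completions `galAdicCompletionMap`). Everything **proved**; no named facts.

* **Finite adeles** (any Dedekind domain `B` with fraction field `L`, any group `G` acting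
  compatibly on `B` and `L`): `galFiniteAdeleMap g : 𝔸_L^∞ →+* 𝔸_L^∞`, `(g x)_w = g (x_{g⁻¹ w})`
  (Mathlib `RestrictedProduct.mapAlongRingHom` along `w ↦ g⁻¹ w`; the restricted-product condition
  is respected because `g 𝒪_{g⁻¹w} = 𝒪_w`), continuous (`RestrictedProduct.mapAlong_continuous`),
  with the cocycle law and `1 ↦ id`; packaged as the instance
  `MulSemiringAction G (FiniteAdeleRing B L)` (+ `ContinuousConstSMul`), with
  `FiniteAdeleRing.smul_apply`/`smul_apply_smul` (components), `smul_algebraMap`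
  (semilinearity over `L`: `g • (x)_𝔸 = (g x)_𝔸`), `SMulDistribClass G L 𝔸_L^∞`, the behaviour
  on the factor inclusions `FiniteAdeleRing.mulSingle`/`single` (`smul_mulSingle`, `smul_single`)
  and on integrality (`forall_smul_apply_mem_iff`).
* **Infinite places** of a number field `E` with `σ ∈ E ≃ₐ[F] E` (Mathlib's action on
  `InfinitePlace E`: `(σ • w) x = w (σ⁻¹ x)`): `galInfiniteCompletionMap σ h : E_w →+* E_{w'}` for
  `σ • w = w'`, the continuous extension of the isometry `σ : (E, |·|_w) → (E, |·|_{σ w})`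
  (`isometry_galWithAbsMap`; Mathlib `UniformSpace.Completion.mapRingHom`), extending `σ`,
  norm-preserving, with cocycle law / `1 ↦ id` / inverse laws and the ring isomorphism
  `galInfiniteCompletionEquiv`.
* **Infinite adeles and adeles**: `(σ • x)_w = σ (x_{σ⁻¹ w})` gives the instances
  `MulSemiringAction (E ≃ₐ[F] E) (InfiniteAdeleRing E)` and
  `MulSemiringAction (E ≃ₐ[F] E) (AdeleRing (𝓞 E) E)` (componentwise on `E_∞ × 𝔸_E^∞`), each
  `σ` acting by a continuous ring automorphism (`AdeleRing.continuous_smul`,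
  `AdeleRing.galRingEquiv`, `AdeleRing.galHomeomorph`), semilinearly over `E`
  (`AdeleRing.smul_algebraMap : σ • (x)_𝔸 = (σ x)_𝔸`, `SMulDistribClass`) and trivially on the
  adeles of `F` in the form `AdeleRing.smul_algebraMap_base`.

Source: Cassels–Fröhlich, Ch. VII (Tate), §1.1 (action of `G` on primes and completions,
`σ_w : L_w → L_{σ w}`, `σ_{τ w} ∘ τ_w = (σ τ)_w`) together with Ch. II (Cassels), §14 (the adele
ring as the restricted product of the completions); the resulting action on `𝔸_L = L ⊗_K 𝔸_K`
is `σ ⊗ 1`. Arthur–Clozel, Ch. 3 §1 use it as "the automorphism `σ` of `G(𝔸_E)`".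

Design notes.
* As in `GaloisActionPlaces`, transports are indexed by a *free* target place and a proof
  `h : σ • w = w'`, so that the component formulas are definitional and no `cast` along
  equalities of places is needed; `*_apply_congr_place` handles equal source places.
* New instances (none of these types carries a Mathlib action): `MulSemiringAction` of `G` on
  `FiniteAdeleRing B L`, of `E ≃ₐ[F] E` on `InfiniteAdeleRing E` and on `AdeleRing (𝓞 E) E`,
  the corresponding `ContinuousConstSMul` and `SMulDistribClass _ L/E _` (Prop-valued) instances.
* No `sorry`, no named facts.

## References

* J. W. S. Cassels, A. Fröhlich (eds.), *Algebraic Number Theory* (1967), Ch. VII (J. Tate),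
  §1.1; Ch. II (J. W. S. Cassels), §14. [CasselsFrohlichANT1967]
* J. Arthur, L. Clozel, *Simple algebras, base change, and the advanced theory of the trace
  formula*, Ann. of Math. Stud. 120 (1989), Ch. 3, §1. [ArthurClozelAMS120]
-/

noncomputable section

open IsDedekindDomain MonoidWithZeroHom MonoidWithZeroHom.ValueGroup₀ WithZero
open scoped Pointwise

namespace Literature.NumberTheory.Automorphic

/-! ## Galois action on the adele ring -/

/-! ### Finite adeles -/

section FiniteAdele

open scoped RestrictedProduct

variable {B : Type*} [CommRing B] [IsDedekindDomain B] {G : Type*} [Group G] [MulSemiringAction G B]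
variable (L : Type*) [Field L] [Algebra B L] [IsFractionRing B L] [MulSemiringAction G L]
  [SMulDistribClass G B L]

variable (B) in
omit [IsDedekindDomain B] in
/-- `w ↦ g⁻¹ • w` tends to the cofinite filter along the cofinite filter (it is injective).
[folklore] -/
theorem tendsto_inv_smul_cofinite (g : G) :
    Filter.Tendsto (fun w : HeightOneSpectrum B => g⁻¹ • w) Filter.cofinite Filter.cofinite :=
  (MulAction.injective g⁻¹).tendsto_cofinite

variable {L} in
/-- **The action of `g ∈ G` on the finite adele ring** `𝔸_L^∞ = ∏'_w L_w`: the component of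
`g • x` at `w` is `g (x_{g⁻¹ w}) ∈ L_w`, the transport `L_{g⁻¹ w} → L_w` along `g`
(Mathlib `RestrictedProduct.mapAlongRingHom`; integrality is preserved at every place, so the
restricted product condition is respected). Cassels–Fröhlich, Ch. VII §1.1 with Ch. II §14
(the adele ring as a restricted product). [cite: CasselsFrohlichANT1967, Ch. VII §1.1] -/
def galFiniteAdeleMap (g : G) : FiniteAdeleRing B L →+* FiniteAdeleRing B L :=
  RestrictedProduct.mapAlongRingHom (fun w : HeightOneSpectrum B => w.adicCompletion L)
    (fun w : HeightOneSpectrum B => w.adicCompletion L) (fun w => g⁻¹ • w)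
    (tendsto_inv_smul_cofinite B g)
    (fun w : HeightOneSpectrum B => galAdicCompletionMap (B := B) (L := L) g (smul_inv_smul g w))
    (Filter.Eventually.of_forall fun (w : HeightOneSpectrum B) y hy =>
      (galAdicCompletionMap_mem_adicCompletionIntegers_iff L g (smul_inv_smul g w) y).mpr hy)

/-- Components of `galFiniteAdeleMap g x`: `(g x)_w = g (x_{g⁻¹ w})` (definitional). [folklore] -/
@[simp] theorem galFiniteAdeleMap_apply (g : G) (x : FiniteAdeleRing B L) (w : HeightOneSpectrum B) :
    galFiniteAdeleMap g x w = galAdicCompletionMap g (smul_inv_smul g w) (x (g⁻¹ • w)) := rfl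

/-- `galFiniteAdeleMap g` is continuous for the restricted product topology. [folklore] -/
theorem continuous_galFiniteAdeleMap (g : G) : Continuous (galFiniteAdeleMap (B := B) (L := L) g) :=
  RestrictedProduct.mapAlong_continuous (fun w : HeightOneSpectrum B => w.adicCompletion L)
    (fun w : HeightOneSpectrum B => w.adicCompletion L) (fun w => g⁻¹ • w)
    (tendsto_inv_smul_cofinite B g)
    (fun w : HeightOneSpectrum B => galAdicCompletionMap (B := B) (L := L) g (smul_inv_smul g w))
    (Filter.Eventually.of_forall fun (w : HeightOneSpectrum B) y hy =>
      (galAdicCompletionMap_mem_adicCompletionIntegers_iff L g (smul_inv_smul g w) y).mpr hy)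
    fun _ => continuous_galAdicCompletionMap L g _

/-- Cocycle law for the action on finite adeles: `g' (g x) = (g' g) x`. [folklore] -/
theorem galFiniteAdeleMap_galFiniteAdeleMap (g g' : G) (x : FiniteAdeleRing B L) :
    galFiniteAdeleMap g' (galFiniteAdeleMap g x) = galFiniteAdeleMap (g' * g) x := by
  refine FiniteAdeleRing.ext L fun w => ?_
  simp only [galFiniteAdeleMap_apply]
  rw [galAdicCompletionMap_galAdicCompletionMap]
  exact galAdicCompletionMap_apply_congr_place L (by rw [mul_inv_rev, mul_smul]) _ _ (⇑x)

/-- The identity acts trivially on finite adeles. [folklore] -/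
theorem galFiniteAdeleMap_one (x : FiniteAdeleRing B L) : galFiniteAdeleMap (1 : G) x = x := by
  refine FiniteAdeleRing.ext L fun w => ?_
  simp only [galFiniteAdeleMap_apply]
  rw [galAdicCompletionMap_apply_congr_place L (show (1 : G)⁻¹ • w = w by simp) _ (one_smul G w) (⇑x),
    galAdicCompletionMap_one]

/-- **`G` acts on the finite adele ring `𝔸_L^∞` by continuous ring automorphisms**
(`g • x := galFiniteAdeleMap g x`). A new instance (no Mathlib action of this type exists).
[cite: CasselsFrohlichANT1967, Ch. VII §1.1] -/
instance instMulSemiringActionFiniteAdeleRing : MulSemiringAction G (FiniteAdeleRing B L) where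
  smul g x := galFiniteAdeleMap g x
  one_smul x := galFiniteAdeleMap_one L x
  mul_smul g g' x := (galFiniteAdeleMap_galFiniteAdeleMap L g' g x).symm
  smul_zero g := map_zero (galFiniteAdeleMap (L := L) g)
  smul_add g x y := map_add (galFiniteAdeleMap (L := L) g) x y
  smul_one g := map_one (galFiniteAdeleMap (L := L) g)
  smul_mul g x y := map_mul (galFiniteAdeleMap (L := L) g) x y

/-- `g • x = galFiniteAdeleMap g x` (definitional). [folklore] -/
theorem FiniteAdeleRing.smul_def (g : G) (x : FiniteAdeleRing B L) : g • x = galFiniteAdeleMap g x :=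
  rfl

/-- Components of `g • x` on finite adeles: `(g • x)_w = g (x_{g⁻¹ w})`. [folklore] -/
@[simp] theorem FiniteAdeleRing.smul_apply (g : G) (x : FiniteAdeleRing B L) (w : HeightOneSpectrum B) :
    (g • x) w = galAdicCompletionMap g (smul_inv_smul g w) (x (g⁻¹ • w)) := rfl

/-- Components of `g • x` at `g • w`: `(g • x)_{g w} = g (x_w)`. [folklore] -/
theorem FiniteAdeleRing.smul_apply_smul (g : G) (x : FiniteAdeleRing B L) (w : HeightOneSpectrum B) :
    (g • x) (g • w) = galAdicCompletionMap g rfl (x w) := by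
  rw [FiniteAdeleRing.smul_apply]
  exact galAdicCompletionMap_apply_congr_place L (inv_smul_smul g w) _ _ (⇑x)

/-- Each `g ∈ G` acts continuously on `𝔸_L^∞`. [folklore] -/
theorem FiniteAdeleRing.continuous_smul (g : G) :
    Continuous (fun x : FiniteAdeleRing B L => g • x) :=
  continuous_galFiniteAdeleMap L g

/-- `G` acts on `𝔸_L^∞` by homeomorphisms (`ContinuousConstSMul`). [folklore] -/
instance instContinuousConstSMulFiniteAdeleRing : ContinuousConstSMul G (FiniteAdeleRing B L) :=
  ⟨FiniteAdeleRing.continuous_smul L⟩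

/-- **Semilinearity**: `g • (x)_𝔸 = (g • x)_𝔸` for the diagonal embedding `L → 𝔸_L^∞`. [folklore] -/
@[simp] theorem FiniteAdeleRing.smul_algebraMap (g : G) (x : L) :
    g • algebraMap L (FiniteAdeleRing B L) x = algebraMap L (FiniteAdeleRing B L) (g • x) := by
  refine FiniteAdeleRing.ext L fun w => ?_
  rw [FiniteAdeleRing.smul_apply, FiniteAdeleRing.algebraMap_apply,
    FiniteAdeleRing.algebraMap_apply, galAdicCompletionMap_coe]

/-- `G` fixes the image of the invariants: if `g • x = x` in `L` then `g • (x)_𝔸 = (x)_𝔸`.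
[folklore] -/
theorem FiniteAdeleRing.smul_algebraMap_of_smul_eq (g : G) {x : L} (hx : g • x = x) :
    g • algebraMap L (FiniteAdeleRing B L) x = algebraMap L (FiniteAdeleRing B L) x := by
  rw [FiniteAdeleRing.smul_algebraMap, hx]

/-- The action of `G` commutes with the `L`-algebra structure twisted by `g`:
`g • (x • a) = (g • x) • (g • a)`. [folklore] -/
instance instSMulDistribClassFiniteAdeleRing : SMulDistribClass G L (FiniteAdeleRing B L) where
  smul_distrib_smul g x a := by
    rw [Algebra.smul_def, Algebra.smul_def, smul_mul', FiniteAdeleRing.smul_algebraMap]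

variable {L} in
/-- The finite adele `(y at w, 1 elsewhere)` (Mathlib `RestrictedProduct.mulSingle`, typed as an
element of `FiniteAdeleRing B L`; this is the idele underlying the Hecke elements `t_{w,i}`).
[folklore] -/
def FiniteAdeleRing.mulSingle [DecidableEq (HeightOneSpectrum B)] (w : HeightOneSpectrum B)
    (y : w.adicCompletion L) : FiniteAdeleRing B L :=
  RestrictedProduct.mulSingle (fun u : HeightOneSpectrum B => u.adicCompletionIntegers L) w y

variable {L} in
/-- The finite adele `(y at w, 0 elsewhere)` (Mathlib `RestrictedProduct.single`, typed as an
element of `FiniteAdeleRing B L`; the factor inclusion `L_w → 𝔸_L^∞`). [folklore] -/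
def FiniteAdeleRing.single [DecidableEq (HeightOneSpectrum B)] (w : HeightOneSpectrum B)
    (y : w.adicCompletion L) : FiniteAdeleRing B L :=
  RestrictedProduct.single (fun u : HeightOneSpectrum B => u.adicCompletionIntegers L) w y

omit [MulSemiringAction G B] [MulSemiringAction G L] [SMulDistribClass G B L] in
/-- `mulSingle w y` has component `y` at `w`. [folklore] -/
@[simp] theorem FiniteAdeleRing.mulSingle_apply_self [DecidableEq (HeightOneSpectrum B)]
    (w : HeightOneSpectrum B) (y : w.adicCompletion L) : FiniteAdeleRing.mulSingle w y w = y :=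
  RestrictedProduct.mulSingle_eq_same _ w y

omit [MulSemiringAction G B] [MulSemiringAction G L] [SMulDistribClass G B L] in
/-- `mulSingle w y` has component `1` away from `w`. [folklore] -/
theorem FiniteAdeleRing.mulSingle_apply_of_ne [DecidableEq (HeightOneSpectrum B)]
    {w u : HeightOneSpectrum B} (y : w.adicCompletion L) (h : u ≠ w) :
    FiniteAdeleRing.mulSingle w y u = 1 :=
  RestrictedProduct.mulSingle_eq_of_ne _ _ h

omit [MulSemiringAction G B] [MulSemiringAction G L] [SMulDistribClass G B L] in
/-- `single w y` has component `y` at `w`. [folklore] -/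
@[simp] theorem FiniteAdeleRing.single_apply_self [DecidableEq (HeightOneSpectrum B)]
    (w : HeightOneSpectrum B) (y : w.adicCompletion L) : FiniteAdeleRing.single w y w = y :=
  RestrictedProduct.single_eq_same _ w y

omit [MulSemiringAction G B] [MulSemiringAction G L] [SMulDistribClass G B L] in
/-- `single w y` has component `0` away from `w`. [folklore] -/
theorem FiniteAdeleRing.single_apply_of_ne [DecidableEq (HeightOneSpectrum B)]
    {w u : HeightOneSpectrum B} (y : w.adicCompletion L) (h : u ≠ w) :
    FiniteAdeleRing.single w y u = 0 :=
  RestrictedProduct.single_eq_of_ne _ _ h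

/-- **The local factor embeddings commute with the action** (multiplicative version):
`g • (y at w, 1 elsewhere) = (g y at g w, 1 elsewhere)`. [folklore] -/
theorem FiniteAdeleRing.smul_mulSingle [DecidableEq (HeightOneSpectrum B)] (g : G)
    (w : HeightOneSpectrum B) (y : w.adicCompletion L) :
    g • FiniteAdeleRing.mulSingle (L := L) w y =
      FiniteAdeleRing.mulSingle (g • w) (galAdicCompletionMap g rfl y) := by
  refine FiniteAdeleRing.ext L fun u => ?_
  rw [FiniteAdeleRing.smul_apply]
  by_cases hu : u = g • w
  · subst hu
    rw [FiniteAdeleRing.mulSingle_apply_self,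
      galAdicCompletionMap_apply_congr_place L (inv_smul_smul g w) _ rfl
        (⇑(FiniteAdeleRing.mulSingle (L := L) w y)),
      FiniteAdeleRing.mulSingle_apply_self]
  · have hu' : g⁻¹ • u ≠ w := fun h => hu (by rw [← h, smul_inv_smul])
    rw [FiniteAdeleRing.mulSingle_apply_of_ne L _ hu', FiniteAdeleRing.mulSingle_apply_of_ne L _ hu,
      map_one]

/-- **The local factor embeddings commute with the action** (additive version):
`g • (y at w, 0 elsewhere) = (g y at g w, 0 elsewhere)`. [folklore] -/
theorem FiniteAdeleRing.smul_single [DecidableEq (HeightOneSpectrum B)] (g : G)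
    (w : HeightOneSpectrum B) (y : w.adicCompletion L) :
    g • FiniteAdeleRing.single (L := L) w y =
      FiniteAdeleRing.single (g • w) (galAdicCompletionMap g rfl y) := by
  refine FiniteAdeleRing.ext L fun u => ?_
  rw [FiniteAdeleRing.smul_apply]
  by_cases hu : u = g • w
  · subst hu
    rw [FiniteAdeleRing.single_apply_self,
      galAdicCompletionMap_apply_congr_place L (inv_smul_smul g w) _ rfl
        (⇑(FiniteAdeleRing.single (L := L) w y)),
      FiniteAdeleRing.single_apply_self]
  · have hu' : g⁻¹ • u ≠ w := fun h => hu (by rw [← h, smul_inv_smul])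
    rw [FiniteAdeleRing.single_apply_of_ne L _ hu', FiniteAdeleRing.single_apply_of_ne L _ hu,
      map_zero]

/-- Integrality at all places is preserved: `g • x ∈ ∏_w 𝒪_w ↔ x ∈ ∏_w 𝒪_w`. [folklore] -/
theorem FiniteAdeleRing.forall_smul_apply_mem_iff (g : G) (x : FiniteAdeleRing B L) :
    (∀ w, (g • x) w ∈ w.adicCompletionIntegers L) ↔ ∀ w, x w ∈ w.adicCompletionIntegers L := by
  constructor
  · intro h w
    have := h (g • w)
    rwa [FiniteAdeleRing.smul_apply_smul, galAdicCompletionMap_mem_adicCompletionIntegers_iff] at this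
  · intro h w
    rw [FiniteAdeleRing.smul_apply, galAdicCompletionMap_mem_adicCompletionIntegers_iff]
    exact h _

end FiniteAdele

/-! ### Infinite places and their completions (number fields) -/

section InfinitePlace

open NumberField

variable (F : Type*) [Field F] {E : Type*} [Field E] [Algebra F E]

/-- The absolute value at a conjugate infinite place: `|σ x|_{σ w} = |x|_w`
(Mathlib `InfinitePlace.smul_apply`: `(σ • w) x = w (σ⁻¹ x)`). [folklore] -/
theorem InfinitePlace.smul_apply_apply (σ : E ≃ₐ[F] E) (w : InfinitePlace E) (x : E) :
    (σ • w) (σ x) = w x := by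
  rw [InfinitePlace.smul_apply, AlgEquiv.symm_apply_apply]

variable {F} in
/-- `σ` as a ring homomorphism `WithAbs w → WithAbs w'` between the normed copies of `E` at two
infinite places. [folklore] -/
def galWithAbsMap (σ : E ≃ₐ[F] E) (w w' : InfinitePlace E) : WithAbs w.1 →+* WithAbs w'.1 :=
  WithAbs.map _ _ σ.toRingEquiv.toRingHom

/-- `galWithAbsMap σ w w' x = σ x` on underlying elements (definitional). [folklore] -/
@[simp] theorem galWithAbsMap_apply (σ : E ≃ₐ[F] E) (w w' : InfinitePlace E) (x : WithAbs w.1) :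
    galWithAbsMap σ w w' x = WithAbs.toAbs w'.1 (σ x.ofAbs) := rfl

/-- For `w' = σ • w`, `σ : WithAbs w → WithAbs w'` is an isometry. [folklore] -/
theorem isometry_galWithAbsMap {σ : E ≃ₐ[F] E} {w w' : InfinitePlace E} (h : σ • w = w') :
    Isometry (galWithAbsMap σ w w') := by
  refine AddMonoidHomClass.isometry_of_norm _ fun x => ?_
  subst h
  change (σ • w) (σ x.ofAbs) = w x.ofAbs
  exact InfinitePlace.smul_apply_apply F σ w x.ofAbs

variable {F} in
/-- **Galois transport of archimedean completions** `σ_w : E_w →+* E_{w'}` for `σ • w = w'`: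
the continuous extension of `σ` (an isometry `WithAbs w → WithAbs w'`). The data do not depend
on the proof `h`. [cite: CasselsFrohlichANT1967, Ch. VII §1.1] -/
def galInfiniteCompletionMap (σ : E ≃ₐ[F] E) {w w' : InfinitePlace E} (h : σ • w = w') :
    w.Completion →+* w'.Completion :=
  (InfinitePlace.Completion.equiv w').symm.toRingHom.comp
    ((UniformSpace.Completion.mapRingHom (galWithAbsMap σ w w')
        (isometry_galWithAbsMap F h).continuous).comp
      (InfinitePlace.Completion.equiv w).toRingHom)

/-- `galInfiniteCompletionMap` extends `σ`. [folklore] -/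
@[simp] theorem galInfiniteCompletionMap_coe (σ : E ≃ₐ[F] E) {w w' : InfinitePlace E}
    (h : σ • w = w') (x : E) :
    galInfiniteCompletionMap σ h (x : w.Completion) = ((σ x : E) : w'.Completion) := by
  apply InfinitePlace.Completion.ext
  simp only [galInfiniteCompletionMap, RingHom.coe_comp, RingEquiv.toRingHom_eq_coe,
    RingHom.coe_coe, Function.comp_apply, InfinitePlace.Completion.equiv_apply]
  change (InfinitePlace.Completion.ofCompletion _).toCompletion = _
  rw [InfinitePlace.Completion.toCompletion_ofCompletion]
  change UniformSpace.Completion.mapRingHom _ _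
    ((WithAbs.toAbs w.1 x : WithAbs w.1) : w.1.Completion) =
    ((WithAbs.toAbs w'.1 (σ x) : WithAbs w'.1) : w'.1.Completion)
  rw [UniformSpace.Completion.mapRingHom_coe]
  rfl

/-- `galInfiniteCompletionMap` is continuous. [folklore] -/
theorem continuous_galInfiniteCompletionMap (σ : E ≃ₐ[F] E) {w w' : InfinitePlace E}
    (h : σ • w = w') : Continuous (galInfiniteCompletionMap σ h) :=
  (InfinitePlace.Completion.continuous_ofCompletion w').comp
    (UniformSpace.Completion.continuous_map.comp
      (InfinitePlace.Completion.continuous_toCompletion w))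

omit [Algebra F E] in
/-- Two continuous maps out of `E_w` (archimedean) that agree on `E` are equal. [folklore] -/
theorem InfinitePlace.Completion.ext_of_coe {X : Type*} [TopologicalSpace X] [T2Space X]
    (w : InfinitePlace E) {f f' : w.Completion → X} (hf : Continuous f) (hf' : Continuous f')
    (h : ∀ x : E, f x = f' x) : f = f' :=
  (InfinitePlace.Completion.denseRange_coe w).equalizer hf hf' (funext fun x => h x.ofAbs)

/-- **`galInfiniteCompletionMap` is an isometry**: `‖σ y‖_{σ w} = ‖y‖_w`. [folklore] -/
theorem norm_galInfiniteCompletionMap (σ : E ≃ₐ[F] E) {w w' : InfinitePlace E} (h : σ • w = w')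
    (y : w.Completion) : ‖galInfiniteCompletionMap σ h y‖ = ‖y‖ := by
  refine congrFun (InfinitePlace.Completion.ext_of_coe w
    (continuous_norm.comp (continuous_galInfiniteCompletionMap F σ h)) continuous_norm
    fun x => ?_) y
  simp only [Function.comp_apply, galInfiniteCompletionMap_coe]
  subst h
  change ‖((WithAbs.toAbs _ (σ x) : WithAbs (σ • w).1) : (σ • w).Completion)‖ =
    ‖((WithAbs.toAbs _ x : WithAbs w.1) : w.Completion)‖
  rw [InfinitePlace.Completion.norm_coe, InfinitePlace.Completion.norm_coe]
  exact InfinitePlace.smul_apply_apply F σ w x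

/-- Cocycle law `σ_{τ w} ∘ τ_w = (σ τ)_w` at infinite places. [cite: CasselsFrohlichANT1967, Ch. VII §1.1] -/
theorem galInfiniteCompletionMap_galInfiniteCompletionMap (σ σ' : E ≃ₐ[F] E)
    {w w' w'' : InfinitePlace E} (h : σ • w = w') (h' : σ' • w' = w'') (y : w.Completion) :
    galInfiniteCompletionMap σ' h' (galInfiniteCompletionMap σ h y) =
      galInfiniteCompletionMap (σ' * σ) ((mul_smul σ' σ w).trans (by rw [h, h'])) y := by
  refine congrFun (InfinitePlace.Completion.ext_of_coe w
    ((continuous_galInfiniteCompletionMap F σ' h').comp (continuous_galInfiniteCompletionMap F σ h))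
    (continuous_galInfiniteCompletionMap F (σ' * σ) _) fun x => ?_) y
  simp only [Function.comp_apply, galInfiniteCompletionMap_coe, AlgEquiv.mul_apply]

/-- The identity acts trivially on `E_w`. [folklore] -/
@[simp] theorem galInfiniteCompletionMap_one {w : InfinitePlace E} (h : (1 : E ≃ₐ[F] E) • w = w)
    (y : w.Completion) : galInfiniteCompletionMap 1 h y = y := by
  refine congrFun (InfinitePlace.Completion.ext_of_coe w
    (continuous_galInfiniteCompletionMap F 1 h) continuous_id fun x => ?_) y
  simp only [galInfiniteCompletionMap_coe, AlgEquiv.one_apply, id_eq]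

/-- `galInfiniteCompletionMap σ h` only depends on `σ`, not on how it is written. [folklore] -/
theorem galInfiniteCompletionMap_congr_left {σ₁ σ₂ : E ≃ₐ[F] E} (hσ : σ₁ = σ₂)
    {w w' : InfinitePlace E} (h₁ : σ₁ • w = w') (h₂ : σ₂ • w = w') (y : w.Completion) :
    galInfiniteCompletionMap σ₁ h₁ y = galInfiniteCompletionMap σ₂ h₂ y := by
  subst hσ; rfl

/-- Transport along an equality of source places for a dependent family (`x w ∈ E_w`). [folklore] -/
theorem galInfiniteCompletionMap_apply_congr_place {σ : E ≃ₐ[F] E} {w₁ w₂ w : InfinitePlace E}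
    (hw : w₁ = w₂) (h₁ : σ • w₁ = w) (h₂ : σ • w₂ = w) (x : ∀ u : InfinitePlace E, u.Completion) :
    galInfiniteCompletionMap σ h₁ (x w₁) = galInfiniteCompletionMap σ h₂ (x w₂) := by
  subst hw; rfl

/-- `σ⁻¹` undoes `σ` on archimedean completions. [folklore] -/
@[simp] theorem galInfiniteCompletionMap_inv_apply (σ : E ≃ₐ[F] E) {w w' : InfinitePlace E}
    (h : σ • w = w') (h' : σ⁻¹ • w' = w) (y : w.Completion) :
    galInfiniteCompletionMap σ⁻¹ h' (galInfiniteCompletionMap σ h y) = y := by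
  rw [galInfiniteCompletionMap_galInfiniteCompletionMap,
    galInfiniteCompletionMap_congr_left F (inv_mul_cancel σ) _ (one_smul _ w),
    galInfiniteCompletionMap_one]

/-- `σ` undoes `σ⁻¹` on archimedean completions. [folklore] -/
@[simp] theorem galInfiniteCompletionMap_apply_inv (σ : E ≃ₐ[F] E) {w w' : InfinitePlace E}
    (h : σ • w = w') (h' : σ⁻¹ • w' = w) (y : w'.Completion) :
    galInfiniteCompletionMap σ h (galInfiniteCompletionMap σ⁻¹ h' y) = y := by
  rw [galInfiniteCompletionMap_galInfiniteCompletionMap,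
    galInfiniteCompletionMap_congr_left F (mul_inv_cancel σ) _ (one_smul _ w'),
    galInfiniteCompletionMap_one]

omit [Algebra F E] in
/-- `σ • w = w'` rearranged: `σ⁻¹ • w' = w` (infinite places). [folklore] -/
theorem InfinitePlace.inv_smul_eq_of_smul_eq {G : Type*} [Group G] [MulAction G (InfinitePlace E)]
    {σ : G} {w w' : InfinitePlace E} (h : σ • w = w') : σ⁻¹ • w' = w := by
  rw [← h, inv_smul_smul]

variable {F} in
/-- Galois transport of archimedean completions as a ring isomorphism `E_w ≃+* E_{σ w}`.
[cite: CasselsFrohlichANT1967, Ch. VII §1.1] -/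
def galInfiniteCompletionEquiv (σ : E ≃ₐ[F] E) {w w' : InfinitePlace E} (h : σ • w = w') :
    w.Completion ≃+* w'.Completion :=
  RingEquiv.ofRingHom (galInfiniteCompletionMap σ h)
    (galInfiniteCompletionMap σ⁻¹ (InfinitePlace.inv_smul_eq_of_smul_eq h))
    (by ext y; simp) (by ext y; simp)

/-- `galInfiniteCompletionEquiv σ h` is `galInfiniteCompletionMap σ h` as a function. [folklore] -/
@[simp] theorem coe_galInfiniteCompletionEquiv (σ : E ≃ₐ[F] E) {w w' : InfinitePlace E}
    (h : σ • w = w') : ⇑(galInfiniteCompletionEquiv σ h) = galInfiniteCompletionMap σ h := rfl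

end InfinitePlace

/-! ### Infinite adeles and adeles (number fields) -/

section Adele

open NumberField

variable (F : Type*) [Field F] {E : Type*} [Field E] [NumberField E] [Algebra F E]

variable {F} in
/-- **The action of `σ ∈ Aut(E/F)` on the infinite adele ring** `E_∞ = ∏_{w ∣ ∞} E_w`:
`(σ x)_w = σ (x_{σ⁻¹ w})`. [cite: CasselsFrohlichANT1967, Ch. VII §1.1] -/
def galInfiniteAdeleMap (σ : E ≃ₐ[F] E) : InfiniteAdeleRing E →+* InfiniteAdeleRing E where
  toFun x w := galInfiniteCompletionMap σ (smul_inv_smul σ w) (x (σ⁻¹ • w))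
  map_one' := funext fun w => map_one (galInfiniteCompletionMap σ (smul_inv_smul σ w))
  map_mul' x y := funext fun w =>
    map_mul (galInfiniteCompletionMap σ (smul_inv_smul σ w)) (x (σ⁻¹ • w)) (y (σ⁻¹ • w))
  map_zero' := funext fun w => map_zero (galInfiniteCompletionMap σ (smul_inv_smul σ w))
  map_add' x y := funext fun w =>
    map_add (galInfiniteCompletionMap σ (smul_inv_smul σ w)) (x (σ⁻¹ • w)) (y (σ⁻¹ • w))

omit [NumberField E] in
/-- Components of `galInfiniteAdeleMap σ x` (definitional). [folklore] -/
@[simp] theorem galInfiniteAdeleMap_apply (σ : E ≃ₐ[F] E) (x : InfiniteAdeleRing E)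
    (w : InfinitePlace E) :
    galInfiniteAdeleMap σ x w = galInfiniteCompletionMap σ (smul_inv_smul σ w) (x (σ⁻¹ • w)) := rfl

omit [NumberField E] in
/-- `galInfiniteAdeleMap σ` is continuous. [folklore] -/
theorem continuous_galInfiniteAdeleMap (σ : E ≃ₐ[F] E) : Continuous (galInfiniteAdeleMap σ) :=
  continuous_pi fun w =>
    (continuous_galInfiniteCompletionMap F σ (smul_inv_smul σ w)).comp (continuous_apply _)

omit [NumberField E] in
/-- Cocycle law for the action on infinite adeles. [folklore] -/
theorem galInfiniteAdeleMap_galInfiniteAdeleMap (σ σ' : E ≃ₐ[F] E) (x : InfiniteAdeleRing E) :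
    galInfiniteAdeleMap σ' (galInfiniteAdeleMap σ x) = galInfiniteAdeleMap (σ' * σ) x := by
  funext w
  simp only [galInfiniteAdeleMap_apply]
  rw [galInfiniteCompletionMap_galInfiniteCompletionMap]
  exact galInfiniteCompletionMap_apply_congr_place F (by rw [mul_inv_rev, mul_smul]) _ _ x

omit [NumberField E] in
/-- The identity acts trivially on infinite adeles. [folklore] -/
theorem galInfiniteAdeleMap_one (x : InfiniteAdeleRing E) :
    galInfiniteAdeleMap (1 : E ≃ₐ[F] E) x = x := by
  funext w
  simp only [galInfiniteAdeleMap_apply]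
  rw [galInfiniteCompletionMap_apply_congr_place F (show (1 : E ≃ₐ[F] E)⁻¹ • w = w by simp) _
    (one_smul _ w) x, galInfiniteCompletionMap_one]

/-- **`Aut(E/F)` acts on the infinite adele ring `E_∞` by continuous ring automorphisms.**
A new instance. [cite: CasselsFrohlichANT1967, Ch. VII §1.1] -/
instance instMulSemiringActionInfiniteAdeleRing :
    MulSemiringAction (E ≃ₐ[F] E) (InfiniteAdeleRing E) where
  smul σ x := galInfiniteAdeleMap σ x
  one_smul x := galInfiniteAdeleMap_one F x
  mul_smul σ σ' x := (galInfiniteAdeleMap_galInfiniteAdeleMap F σ' σ x).symm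
  smul_zero σ := map_zero (galInfiniteAdeleMap σ)
  smul_add σ x y := map_add (galInfiniteAdeleMap σ) x y
  smul_one σ := map_one (galInfiniteAdeleMap σ)
  smul_mul σ x y := map_mul (galInfiniteAdeleMap σ) x y

omit [NumberField E] in
/-- Components of `σ • x` on infinite adeles: `(σ • x)_w = σ (x_{σ⁻¹ w})`. [folklore] -/
@[simp] theorem InfiniteAdeleRing.smul_apply (σ : E ≃ₐ[F] E) (x : InfiniteAdeleRing E)
    (w : InfinitePlace E) :
    (σ • x) w = galInfiniteCompletionMap σ (smul_inv_smul σ w) (x (σ⁻¹ • w)) := rfl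

omit [NumberField E] in
/-- Components of `σ • x` at `σ • w`: `(σ • x)_{σ w} = σ (x_w)`. [folklore] -/
theorem InfiniteAdeleRing.smul_apply_smul (σ : E ≃ₐ[F] E) (x : InfiniteAdeleRing E)
    (w : InfinitePlace E) : (σ • x) (σ • w) = galInfiniteCompletionMap σ rfl (x w) := by
  rw [InfiniteAdeleRing.smul_apply]
  exact galInfiniteCompletionMap_apply_congr_place F (inv_smul_smul σ w) _ _ x

omit [NumberField E] in
/-- Each `σ` acts continuously on `E_∞`. [folklore] -/
theorem InfiniteAdeleRing.continuous_smul (σ : E ≃ₐ[F] E) :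
    Continuous (fun x : InfiniteAdeleRing E => σ • x) :=
  continuous_galInfiniteAdeleMap F σ

/-- `Aut(E/F)` acts on `E_∞` by homeomorphisms. [folklore] -/
instance instContinuousConstSMulInfiniteAdeleRing :
    ContinuousConstSMul (E ≃ₐ[F] E) (InfiniteAdeleRing E) :=
  ⟨InfiniteAdeleRing.continuous_smul F⟩

omit [NumberField E] in
/-- Semilinearity on `E_∞`: `σ • (x)_∞ = (σ x)_∞`. [folklore] -/
@[simp] theorem InfiniteAdeleRing.smul_algebraMap (σ : E ≃ₐ[F] E) (x : E) :
    σ • algebraMap E (InfiniteAdeleRing E) x = algebraMap E (InfiniteAdeleRing E) (σ x) := by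
  funext w
  rw [InfiniteAdeleRing.smul_apply, InfiniteAdeleRing.algebraMap_apply,
    InfiniteAdeleRing.algebraMap_apply, galInfiniteCompletionMap_coe]

omit [NumberField E] in
/-- `σ • (a)_∞ = (a)_∞` for `a ∈ F`. [folklore] -/
theorem InfiniteAdeleRing.smul_algebraMap_base (σ : E ≃ₐ[F] E) (a : F) :
    σ • algebraMap E (InfiniteAdeleRing E) (algebraMap F E a) =
      algebraMap E (InfiniteAdeleRing E) (algebraMap F E a) := by
  rw [InfiniteAdeleRing.smul_algebraMap, AlgEquiv.commutes]

omit [NumberField E] in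
/-- Norms of components are permuted: `‖(σ • x)_{σ w}‖ = ‖x_w‖`. [folklore] -/
theorem InfiniteAdeleRing.norm_smul_apply_smul (σ : E ≃ₐ[F] E) (x : InfiniteAdeleRing E)
    (w : InfinitePlace E) : ‖(σ • x) (σ • w)‖ = ‖x w‖ := by
  rw [InfiniteAdeleRing.smul_apply_smul, norm_galInfiniteCompletionMap]

/-- **`Aut(E/F)` acts on the adele ring `𝔸_E = E_∞ × 𝔸_E^∞` by continuous ring
automorphisms** (componentwise on the two factors). A new instance.
[cite: CasselsFrohlichANT1967, Ch. VII §1.1] -/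
instance instMulSemiringActionAdeleRing : MulSemiringAction (E ≃ₐ[F] E) (AdeleRing (𝓞 E) E) where
  smul σ x := (σ • x.1, σ • x.2)
  one_smul x := Prod.ext (one_smul _ x.1) (one_smul _ x.2)
  mul_smul σ σ' x := Prod.ext (mul_smul σ σ' x.1) (mul_smul σ σ' x.2)
  smul_zero σ := Prod.ext (smul_zero σ) (smul_zero σ)
  smul_add σ x y := Prod.ext (smul_add σ x.1 y.1) (smul_add σ x.2 y.2)
  smul_one σ := Prod.ext (smul_one σ) (smul_one σ)
  smul_mul σ x y := Prod.ext (smul_mul' σ x.1 y.1) (smul_mul' σ x.2 y.2)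

/-- The archimedean part of `σ • x` is `σ • x.1` (definitional). [folklore] -/
@[simp] theorem AdeleRing.smul_fst (σ : E ≃ₐ[F] E) (x : AdeleRing (𝓞 E) E) : (σ • x).1 = σ • x.1 :=
  rfl

/-- The finite part of `σ • x` is `σ • x.2` (definitional). [folklore] -/
@[simp] theorem AdeleRing.smul_snd (σ : E ≃ₐ[F] E) (x : AdeleRing (𝓞 E) E) : (σ • x).2 = σ • x.2 :=
  rfl

/-- `σ • (x∞, xf) = (σ • x∞, σ • xf)` (definitional). [folklore] -/
theorem AdeleRing.smul_mk (σ : E ≃ₐ[F] E) (x : InfiniteAdeleRing E) (y : FiniteAdeleRing (𝓞 E) E) :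
    σ • ((x, y) : AdeleRing (𝓞 E) E) = (σ • x, σ • y) := rfl

/-- Each `σ` acts continuously on `𝔸_E`. [folklore] -/
theorem AdeleRing.continuous_smul (σ : E ≃ₐ[F] E) : Continuous (fun x : AdeleRing (𝓞 E) E => σ • x) :=
  ((InfiniteAdeleRing.continuous_smul F σ).comp continuous_fst).prodMk
    ((FiniteAdeleRing.continuous_smul E σ).comp continuous_snd)

/-- `Aut(E/F)` acts on `𝔸_E` by homeomorphisms. [folklore] -/
instance instContinuousConstSMulAdeleRing : ContinuousConstSMul (E ≃ₐ[F] E) (AdeleRing (𝓞 E) E) :=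
  ⟨AdeleRing.continuous_smul F⟩

/-- `σ` as a continuous ring automorphism of `𝔸_E` (Mathlib `MulSemiringAction.toRingEquiv`).
[cite: CasselsFrohlichANT1967, Ch. VII §1.1] -/
abbrev AdeleRing.galRingEquiv (σ : E ≃ₐ[F] E) : AdeleRing (𝓞 E) E ≃+* AdeleRing (𝓞 E) E :=
  MulSemiringAction.toRingEquiv (E ≃ₐ[F] E) (AdeleRing (𝓞 E) E) σ

/-- `AdeleRing.galRingEquiv σ` as a homeomorphism of `𝔸_E`. [folklore] -/
def AdeleRing.galHomeomorph (σ : E ≃ₐ[F] E) : AdeleRing (𝓞 E) E ≃ₜ AdeleRing (𝓞 E) E where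
  toEquiv := (AdeleRing.galRingEquiv F σ).toEquiv
  continuous_toFun := AdeleRing.continuous_smul F σ
  continuous_invFun := AdeleRing.continuous_smul F σ⁻¹

/-- **Semilinearity on `𝔸_E`**: `σ • (x)_𝔸 = (σ x)_𝔸` for the diagonal embedding `E → 𝔸_E`.
[folklore] -/
@[simp] theorem AdeleRing.smul_algebraMap (σ : E ≃ₐ[F] E) (x : E) :
    σ • algebraMap E (AdeleRing (𝓞 E) E) x = algebraMap E (AdeleRing (𝓞 E) E) (σ x) :=
  Prod.ext (InfiniteAdeleRing.smul_algebraMap F σ x) (FiniteAdeleRing.smul_algebraMap E σ x)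

/-- **`Aut(E/F)` fixes the adeles of `F`**: `σ • (a)_𝔸 = (a)_𝔸` for `a ∈ F`. [folklore] -/
theorem AdeleRing.smul_algebraMap_base (σ : E ≃ₐ[F] E) (a : F) :
    σ • algebraMap E (AdeleRing (𝓞 E) E) (algebraMap F E a) =
      algebraMap E (AdeleRing (𝓞 E) E) (algebraMap F E a) := by
  rw [AdeleRing.smul_algebraMap, AlgEquiv.commutes]

/-- `σ • (x • a) = σ x • σ • a` on `𝔸_E`. [folklore] -/
instance instSMulDistribClassAdeleRing : SMulDistribClass (E ≃ₐ[F] E) E (AdeleRing (𝓞 E) E) where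
  smul_distrib_smul σ x a := by
    rw [Algebra.smul_def, Algebra.smul_def, smul_mul', AdeleRing.smul_algebraMap, AlgEquiv.smul_def]

end Adele

end Literature.NumberTheory.Automorphic
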